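import Summits.HodgeConjecture.CorCM.GaloisDihedralDegenerateTypes
import Summits.HodgeConjecture.CorCM.CMFieldAllTypesHereditaryCriterion
import HarnessLib

/-!
# The dihedral obstruction is HEREDITARY UPWARD: a CM field with a dihedral CM subfield of order `4n ≥ 20` carries
# abelian varieties which are not stably nondegenerate

COR-CM (cell `pub-hodgecm2`), binder seat b04 (gen 22), count-neutral claim GALOIS-DIHEDRAL, part VII — a corollary of
part III (`exists_isPrimitive_not_isNondegenerate_dihedral`) and gen 21's HEREDITARY CRITERION
(`HereditaryCriterion.forall_isStablyNondegenerate_iff_hereditary`: ALL abelian varieties `X` with `K ↪ End⁰(X)`,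
`[K:ℚ] = 2 dim X`, are stably nondegenerate ⟺ every primitive CM type of every intermediate field of `K` is
nondegenerate).  KERNEL ONLY: theorems; no definition, no named fact, no `sorry`.  `HC_CM` is neither used nor claimed.

If a CM field `K` (no Galois hypothesis on `K`) has an intermediate field `E` which is a Galois CM field with
`Gal(E/ℚ) ≅ DihedralGroup (2n)`, `n ≥ 5`, then the primitive degenerate mirror type of `E` (part III) lifts: NOT every
abelian variety with complex multiplication by `K` is stably nondegenerate (`not_forall_isStablyNondegenerate_of_dihedral_
intermediateField`), i.e. some `X` with `K ↪ End⁰(X)`, `[K:ℚ] = 2 dim X` — isogenous to a power of a simple degenerate CM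
`2n`-fold — carries an exceptional Hodge class on a power.  Realisation form included.

## References

* [Shimura1998] G. Shimura, *Abelian Varieties with Complex Multiplication and Modular Functions*, §5.1 Prop. 3, §5.2,
  §8.2 Prop. 26.
* [Gordon1999HodgeAVSurvey] B. B. Gordon, *A survey of the Hodge conjecture for abelian varieties*, Thm. 6.4, §9.3.
-/

noncomputable section

open CategoryTheory CategoryTheory.Limits NumberField

namespace Summit.HodgeConjecture.CorCM.GaloisDihedral

open Literature.NumberTheory.ComplexMultiplication
open Literature.AlgebraicGeometry Literature.AlgebraicGeometry.Motives Literature.AlgebraicGeometry.HodgeTheory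
open Literature.AlgebraicGeometry.Motives.AbelianVariety
open Literature.AlgebraicGeometry.ComplexMultiplication
open Literature.AlgebraicGeometry.Pohlmann1968

variable {K : Type} [Field K] [NumberField K] [IsCMField K]

/-- **A dihedral CM subfield of order `4n ≥ 20` obstructs ALL-X.**  `E ≤ K` an intermediate field, Galois over `ℚ`
and CM, with `Gal(E/ℚ) ≅ DihedralGroup (2n)`, `n ≥ 5`: it is false that every `X` with `K ↪ End⁰(X)`,
`[K:ℚ] = 2 dim X`, is stably nondegenerate. [cite: Shimura1998, §5.1 Prop. 3 and §8.2 Prop. 26]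
[cite: Gordon1999HodgeAVSurvey, Thm. 6.4] -/
theorem not_forall_isStablyNondegenerate_of_dihedral_intermediateField (E : IntermediateField ℚ K) [IsCMField E]
    [IsGalois ℚ E] {n : ℕ} (hn : 5 ≤ n) (e₀ : (E ≃ₐ[ℚ] E) ≃* DihedralGroup (2 * n)) :
    ¬ ∀ (X : AbelianVariety ℂ) (_ : K →+* X.endAlgebra), Module.finrank ℚ K = 2 * X.dim → IsStablyNondegenerate X := by
  intro h
  obtain ⟨ψ₀⟩ := (inferInstance : Nonempty (E →+* ℂ))
  obtain ⟨Ψ, hprim, hdeg⟩ := exists_isPrimitive_not_isNondegenerate_dihedral hn e₀ ψ₀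
  exact hdeg (HereditaryCriterion.isNondegenerate_of_forall_isStablyNondegenerate h E Ψ ψ₀ hprim)

/-- **Realisation form**: with such a subfield, NOT every abelian variety `(A, ι)` of every CM type `(K; Φ)` is stably
nondegenerate. [cite: Shimura1998, §5.1 Prop. 3 and §8.2 Prop. 26] [cite: Gordon1999HodgeAVSurvey, Thm. 6.4] -/
theorem not_forall_realisation_isStablyNondegenerate_of_dihedral_intermediateField (E : IntermediateField ℚ K)
    [IsCMField E] [IsGalois ℚ E] {n : ℕ} (hn : 5 ≤ n) (e₀ : (E ≃ₐ[ℚ] E) ≃* DihedralGroup (2 * n)) :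
    ¬ ∀ (Φ : CMType K) (A : AbelianVariety ℂ) (ι : 𝓞 K →+* End A) (θ : K →+* Module.End ℂ (complexBetti A.X 1)),
        IsCMTypeRealisation Φ A ι θ → IsStablyNondegenerate A := by
  intro h
  obtain ⟨ψ₀⟩ := (inferInstance : Nonempty (E →+* ℂ))
  obtain ⟨Ψ, hprim, hdeg⟩ := exists_isPrimitive_not_isNondegenerate_dihedral hn e₀ ψ₀
  exact hdeg ((HereditaryCriterion.forall_realisation_isStablyNondegenerate_iff_hereditary.1 h) E Ψ ψ₀ hprim)

/-- **The case `E = K` as an intermediate field is not needed: for `K` itself** (Galois, dihedral of order `4n ≥ 20`)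
some abelian variety with CM by `K` — e.g. the simple degenerate one of part III — is not stably nondegenerate.
[cite: Gordon1999HodgeAVSurvey, Thm. 6.4] -/
theorem exists_not_isStablyNondegenerate_dihedral [IsGalois ℚ K] {n : ℕ} (hn : 5 ≤ n)
    (e : (K ≃ₐ[ℚ] K) ≃* DihedralGroup (2 * n)) :
    ∃ (Φ : CMType K) (A : AbelianVariety ℂ) (ι : 𝓞 K →+* End A) (θ : K →+* Module.End ℂ (complexBetti A.X 1)),
      IsCMTypeRealisation Φ A ι θ ∧ A.IsSimple ∧ ¬ IsStablyNondegenerate A := by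
  obtain ⟨Φ, φ₀, A, ι, θ, hprim, hdeg, hA, hs, -, -⟩ := exists_simple_degenerate_of_mulEquiv_dihedral hn e
  exact ⟨Φ, A, ι, θ, hA, hs, fun hst => hdeg ((isStablyNondegenerate_iff_isNondegenerate φ₀ hprim hA).1 hst)⟩

end Summit.HodgeConjecture.CorCM.GaloisDihedral

end
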